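import Mathlib
import Literature.NumberTheory.LFunctions.Zhang2022.Section7MeanSquareMajorant
import Literature.NumberTheory.LFunctions.Zhang2022.TypedSection17NuStarBound
import Literature.NumberTheory.LFunctions.Zhang2022.Section12Ded1217Sizes
import Literature.NumberTheory.LFunctions.Zhang2022.Section4GaussianWeight
import HarnessLib

/-!
# Zhang (2022) §17.u007: the pointwise sizes `η ≍ 𝓛⁻⁸` of the replaced factors below `D⁴`

Topic `Literature/NumberTheory/LFunctions/Zhang2022` (Landau–Siegel audit tree; verdict-neutral).
Y. Zhang, *Discrete mean estimates and the Landau–Siegel zero*, arXiv:2211.02515v1 (2022)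
[Zhang2022LandauSiegel] — **an unrefereed manuscript under adjudication**; nothing here asserts or
denies its Theorems 1–2. DAG node `Z22:§17.u007` [Z22 p.96, tex L4735–L4747]: the three replacements
"`κ₂(n₁) ↦ (1∗μ)(n₁)`", "`χ(n₂n₃)(ϰ₁+ι₂ϰ₂)(ῑ₃ϰ₃+ῑ₄ϰ₄) ↦ 𝔢₀χ(n₂n₃)`", "`g̃₂(n₅), g̃₃(n₆) ↦ 1`" each change a
factor by `O(𝓛⁻⁸)` POINTWISE on `1 ≤ m < D⁴` (`log m ≤ 4𝓛`, `|β_j| ≍ α = π𝓛⁻⁹`, `log P_j ≍ 𝓛⁹`,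
`1 − g(T²/m) ≤ ½e^{−𝓛³⁰}` once `T² ≥ eD⁴`). PROVED here (theorems only; no definitions, no named facts),
for the hypotheses of `U007.norm_nuStar_sub_frake0D_nu_le_of_bounds` (`Section17U007NuStar`):

* `norm_powI_sub_one_le` — `|m^{−β₁} − 1| ≤ 8(1+5|c′|π)·α𝓛`;
* `norm_nN_sub_one_le` — `|m^{−β}g*(T²/m) − 1| ≤ 24(1+5|c′|π)·α𝓛 + 20160𝓛⁻⁸` (`β = β₂, β₃`);
* `norm_vkFactor_sub_le` — `|(1 − log m/log P)(P/m)^β − P^β| ≤ 2|β|log m + log m/log P` (`re β = 0`),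
  whence `norm_A1_sub_le`, `norm_A2_sub_le` for `ϰ₁+ι₂ϰ₂`, `ῑ₃ϰ₃+ῑ₄ϰ₄` at `η = (20π+10)𝓛⁻⁸`;
* `vk1_one`, `vk3_one`, `norm_vk2_one_sub_le`, `norm_frake0D_sub_frake0_le` — `ϰ₁(1) = e^{0.756πi}`,
  `ϰ₃(1) = e^{0.747πi}` exactly, `|ϰ₂(1) − e^{1.25πi}| ≤ 50α𝓛²`, so
  `|𝔢₀ᴰ − 𝔢₀| ≤ 100(1+|ι₂|)(|ι₃|+|ι₄|)α𝓛²` ((17.4): `Typed.Section17.frake0D` vs `Skeleton.frake0`).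

ZHANG-L discharge lane (WP16, seat zl-w16-p6), toward the leaf `Typed.Section17.Eq17_6Rel`. WHAT THIS
IS NOT: a claim about Theorems 1–2 of the source or about Landau–Siegel zeros.

## References

* Y. Zhang, arXiv:2211.02515v1 (2022), §17 u007 p.96, (17.4); §8 (8.6); §2 (2.10)–(2.13); §4 (4.2).
  [cite: Zhang2022LandauSiegel, §17 u007 p.96]
-/

noncomputable section

open Finset Complex
open scoped ComplexConjugate Real
open Literature.NumberTheory.LFunctions.Zhang2022.MeanSquareMajorant
open Literature.NumberTheory.LFunctions.Zhang2022.Skeleton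
open Literature.NumberTheory.LFunctions.Zhang2022.Typed.Section17

namespace Literature.NumberTheory.LFunctions.Zhang2022.U007

variable (c' : ℝ) {D : ℕ} (χ : DirichletCharacter ℂ D)

/-! ## Two elementary facts -/

omit χ in
/-- `log m ≤ 4𝓛` for `m < D⁴` (the range of §17.u007). [cite: Zhang2022LandauSiegel, §17 u007 p.96] -/
theorem log_le_four_ell {m : ℕ} (hm : m < D ^ 4) : Real.log m ≤ 4 * ell D := by
  rcases Nat.eq_zero_or_pos m with rfl | hm0
  · simp only [Nat.cast_zero, Real.log_zero]; exact mul_nonneg (by norm_num) (Real.log_natCast_nonneg D)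
  · calc Real.log m ≤ Real.log ((D : ℝ) ^ 4) :=
          Real.log_le_log (by exact_mod_cast hm0) (by exact_mod_cast hm.le)
      _ = 4 * ell D := by rw [Real.log_pow, ell]; norm_num

omit χ in
/-- `|m^{−z} − 1| ≤ 2|z| log m` when `|z| log m ≤ 1` (`m ≥ 1`): `m^{−z} = e^{−z log m}` and
`|e^w − 1| ≤ 2|w|` for `|w| ≤ 1` (the size of the shifts `n^{−β_j} − 1`, (2.13)).
[cite: Zhang2022LandauSiegel, §2 (2.13); §17 u007 p.96] -/
theorem norm_natCast_cpow_neg_sub_one_le {m : ℕ} (hm : m ≠ 0) (z : ℂ) (h : ‖z‖ * Real.log m ≤ 1) :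
    ‖(m : ℂ) ^ (-z) - 1‖ ≤ 2 * ‖z‖ * Real.log m := by
  have hm' : (m : ℂ) ≠ 0 := Nat.cast_ne_zero.mpr hm
  rw [Complex.cpow_def_of_ne_zero hm', ← Complex.natCast_log]
  have hn : ‖(Real.log m : ℂ) * -z‖ = ‖z‖ * Real.log m := by
    rw [norm_mul, norm_neg, Complex.norm_real, Real.norm_of_nonneg (Real.log_natCast_nonneg m), mul_comm]
  have := Complex.norm_exp_sub_one_le (x := (Real.log m : ℂ) * -z) (by rw [hn]; exact h)
  rw [hn] at this
  linarith

/-! ## The shift factor `κ₂ ↦ 1∗μ`: `|m^{−β₁} − 1|` -/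

omit χ in
/-- `|b₁| ≤ (1+5|c′|π)α` (`b₁ = α(1−5c′α𝓛)`, `α𝓛 ≤ π`). [cite: Zhang2022LandauSiegel, §2 (2.13)] -/
theorem abs_b1_le (hD : 1 ≤ Real.log D) : |b1 c' D| ≤ (1 + 5 * |c'| * π) * alpha D := by
  have hα := Sec12D.alpha_pos_of_log (D := D) hD
  have hαℓ := Sec12D.alpha_mul_ell_le (D := D) hD
  rw [b1, abs_mul, abs_of_pos hα]
  have : |1 - 5 * c' * alpha D * ell D| ≤ 1 + 5 * |c'| * π := by
    calc |1 - 5 * c' * alpha D * ell D| ≤ |(1 : ℝ)| + |5 * c' * alpha D * ell D| := abs_sub _ _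
      _ = 1 + 5 * |c'| * (alpha D * ell D) := by
          rw [abs_one, show 5 * c' * alpha D * ell D = 5 * c' * (alpha D * ell D) by ring, abs_mul,
            abs_mul, abs_of_nonneg (by positivity : (0 : ℝ) ≤ alpha D * ell D)]
          norm_num
      _ ≤ 1 + 5 * |c'| * π := by gcongr
  nlinarith [abs_nonneg c']

omit χ in
/-- **`|m^{−β₁} − 1| ≤ 8(1+5|c′|π)·α𝓛`** for `1 ≤ m < D⁴`, once `4(1+5|c′|π)α𝓛 ≤ 1` (`κ₂ = m^{−β₁} ∗ μ`,
`MeanSquareMajorant.powI b₁`). [cite: Zhang2022LandauSiegel, §17 u007 p.96; §2 (2.13)] -/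
theorem norm_powI_sub_one_le (hD : 1 ≤ Real.log D) (hsmall : 4 * (1 + 5 * |c'| * π) * (alpha D * ell D) ≤ 1)
    {m : ℕ} (hm : m ≠ 0) (hm4 : m < D ^ 4) :
    ‖powI (b1 c' D) m - 1‖ ≤ 8 * (1 + 5 * |c'| * π) * (alpha D * ell D) := by
  rw [powI_apply_of_ne_zero _ hm]
  have hlog := log_le_four_ell (D := D) hm4
  have hlog0 : 0 ≤ Real.log m := Real.log_natCast_nonneg m
  have hb := abs_b1_le c' hD
  have hz : ‖(b1 c' D : ℂ) * I‖ = |b1 c' D| := by rw [norm_mul, Complex.norm_I, mul_one, Complex.norm_real, Real.norm_eq_abs]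
  have hA : 0 ≤ (1 + 5 * |c'| * π) * alpha D := le_trans (abs_nonneg _) hb
  have h1 : ‖(b1 c' D : ℂ) * I‖ * Real.log m ≤ (1 + 5 * |c'| * π) * alpha D * (4 * ell D) := by
    rw [hz]; exact mul_le_mul hb hlog hlog0 hA
  have h := norm_natCast_cpow_neg_sub_one_le hm ((b1 c' D : ℂ) * I) (by nlinarith)
  calc ‖(m : ℂ) ^ (-((b1 c' D : ℂ) * I)) - 1‖ ≤ 2 * ‖(b1 c' D : ℂ) * I‖ * Real.log m := h
    _ ≤ 2 * ((1 + 5 * |c'| * π) * alpha D * (4 * ell D)) := by nlinarith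
    _ = 8 * (1 + 5 * |c'| * π) * (alpha D * ell D) := by ring

/-! ## The Gaussian factors `g̃ ↦ 1`: `|m^{−β}g*(T²/m) − 1|` -/

omit χ in
/-- `0 ≤ 1 − g*(y) ≤ ½e^{−𝓛³⁰}` for `y ≥ e` (`g* = g` there, (4.2) at `Λ = 𝓛³⁰`, `log y ≥ 1`), and
`½e^{−𝓛³⁰} ≤ 20160𝓛⁻⁸` (`𝓛 ≥ 1`: `e^{𝓛} ≥ 𝓛⁸/8!`). [cite: Zhang2022LandauSiegel, §4 (4.2)] -/
theorem one_sub_gstar_bounds (hℓ : 1 ≤ ell D) {y : ℝ} (hy : Real.exp 1 ≤ y) :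
    0 ≤ 1 - gstar D y ∧ 1 - gstar D y ≤ 20160 * (ell D ^ 8)⁻¹ := by
  have hℓ0 : 0 < ell D := by linarith
  have h30 : 0 < ell D ^ 30 := by positivity
  have hy1 : 1 ≤ y := le_trans (by have := Real.add_one_le_exp (1 : ℝ); linarith) hy
  have hy2 : 1 / 2 < y := by linarith
  rw [gstar, if_pos hy2, gW]
  obtain ⟨h0, h1⟩ := GaussWeight.one_sub_gWeight_le h30 hy1
  refine ⟨h0, h1.trans ?_⟩
  have hlogy : 1 ≤ Real.log y := by
    rw [← Real.log_exp 1]; exact Real.log_le_log (Real.exp_pos 1) hy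
  have hsq : 1 ≤ Real.log y ^ 2 := one_le_pow₀ hlogy
  have hexp1 : Real.exp (-(ell D ^ 30) * Real.log y ^ 2) ≤ Real.exp (-ell D) := by
    apply Real.exp_le_exp.mpr
    have h1' : ell D ≤ ell D ^ 30 := le_self_pow₀ hℓ (by norm_num)
    nlinarith
  have hexp2 : Real.exp (-ell D) ≤ 40320 * (ell D ^ 8)⁻¹ := by
    have h := Real.pow_div_factorial_le_exp (ell D) hℓ0.le 8
    rw [show (Nat.factorial 8 : ℝ) = 40320 by norm_num] at h
    rw [Real.exp_neg, inv_le_comm₀ (Real.exp_pos _) (by positivity)]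
    calc (40320 * (ell D ^ 8)⁻¹)⁻¹ = ell D ^ 8 / 40320 := by
          rw [mul_inv, inv_inv]; ring
      _ ≤ Real.exp (ell D) := h
  linarith

omit χ in
/-- **`|m^{−β}g*(T²/m) − 1| ≤ 24(1+5|c′|π)α𝓛 + 20160𝓛⁻⁸`** for `1 ≤ m < D⁴`, `β ∈ {β₂, β₃}`, once
`12(1+5|c′|π)α𝓛 ≤ 1` and `eD⁴ ≤ T²` (`Typed.Section17.nN`). [cite: Zhang2022LandauSiegel, §17 u007 p.96] -/
theorem norm_nN_sub_one_le (hD : 1 ≤ Real.log D)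
    (hsmall : 12 * (1 + 5 * |c'| * π) * (alpha D * ell D) ≤ 1)
    (hT : Real.exp 1 * (D : ℝ) ^ 4 ≤ bigT D ^ 2) {β : ℂ} (hβ : ‖β‖ ≤ 3 * alpha D * (1 + 5 * |c'| * π))
    {m : ℕ} (hm : m ≠ 0) (hm4 : m < D ^ 4) :
    ‖nN D β m - 1‖ ≤ 24 * (1 + 5 * |c'| * π) * (alpha D * ell D) + 20160 * (ell D ^ 8)⁻¹ := by
  have hℓ : 1 ≤ ell D := by rw [ell]; exact hD
  have hlog := log_le_four_ell (D := D) hm4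
  have hlog0 : 0 ≤ Real.log m := Real.log_natCast_nonneg m
  have hα := Sec12D.alpha_pos_of_log (D := D) hD
  have hm0 : (0 : ℝ) < m := by exact_mod_cast Nat.pos_of_ne_zero hm
  -- `T²/m ≥ e`
  have hy : Real.exp 1 ≤ bigT D ^ 2 / m := by
    rw [le_div_iff₀ hm0]
    have hmD : (m : ℝ) ≤ (D : ℝ) ^ 4 := by exact_mod_cast hm4.le
    calc Real.exp 1 * m ≤ Real.exp 1 * (D : ℝ) ^ 4 := mul_le_mul_of_nonneg_left hmD (Real.exp_pos 1).le
      _ ≤ bigT D ^ 2 := hT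
  obtain ⟨hg0, hg1⟩ := one_sub_gstar_bounds (D := D) hℓ hy
  have hgle : ‖(gstar D (bigT D ^ 2 / m) : ℂ)‖ ≤ 1 := norm_gstar_le_one (by linarith) _
  -- `|m^{−β} − 1| ≤ 24 A α𝓛`
  have hA0 : 0 ≤ 3 * alpha D * (1 + 5 * |c'| * π) :=
    mul_nonneg (mul_nonneg (by norm_num) hα.le) (by positivity)
  have h1 : ‖β‖ * Real.log m ≤ 3 * alpha D * (1 + 5 * |c'| * π) * (4 * ell D) :=
    mul_le_mul hβ hlog hlog0 hA0
  have hpow := norm_natCast_cpow_neg_sub_one_le hm β (by nlinarith)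
  -- combine
  rw [nN]
  have hsplit : (m : ℂ) ^ (-β) * (gstar D (bigT D ^ 2 / m) : ℂ) - 1 =
      ((m : ℂ) ^ (-β) - 1) * (gstar D (bigT D ^ 2 / m) : ℂ) - ((1 - gstar D (bigT D ^ 2 / m) : ℝ) : ℂ) := by
    push_cast; ring
  rw [hsplit]
  have hpart1 : ‖((m : ℂ) ^ (-β) - 1) * (gstar D (bigT D ^ 2 / m) : ℂ)‖ ≤ 2 * ‖β‖ * Real.log m := by
    rw [norm_mul]
    calc ‖(m : ℂ) ^ (-β) - 1‖ * ‖(gstar D (bigT D ^ 2 / m) : ℂ)‖ ≤ ‖(m : ℂ) ^ (-β) - 1‖ * 1 :=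
          mul_le_mul_of_nonneg_left hgle (norm_nonneg _)
      _ ≤ 2 * ‖β‖ * Real.log m := by rw [mul_one]; exact hpow
  have hpart2 : ‖((1 - gstar D (bigT D ^ 2 / m) : ℝ) : ℂ)‖ ≤ 20160 * (ell D ^ 8)⁻¹ := by
    rw [Complex.norm_real, Real.norm_of_nonneg hg0]; exact hg1
  have h2 : 2 * ‖β‖ * Real.log m ≤ 24 * (1 + 5 * |c'| * π) * (alpha D * ell D) := by nlinarith [norm_nonneg β]
  exact (norm_sub_le _ _).trans (by linarith)

/-! ## The `ϰ`-factors `ϰ_j(m) ↦ ϰ_j(1)` -/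

omit χ in
/-- **`|(1 − log m/log P)(P/m)^β − (1 − log 1/log P)(P/1)^β| ≤ 2|β| log m + log m/log P`** for
`1 ≤ m < P`, `re β = 0`, `|β| log m ≤ 1` ((8.6): `(P/m)^β = P^β m^{−β}`, `|P^β| = 1`).
[cite: Zhang2022LandauSiegel, §8 (8.6)] -/
theorem norm_vkFactor_sub_le {P : ℝ} (hP : 1 < P) {β : ℂ} (hβ : β.re = 0) {m : ℕ} (hm : m ≠ 0)
    (hsmall : ‖β‖ * Real.log m ≤ 1) :
    ‖((1 - Real.log m / Real.log P : ℝ) : ℂ) * ((P / m : ℝ) : ℂ) ^ β -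
        ((1 - Real.log (1 : ℕ) / Real.log P : ℝ) : ℂ) * ((P / (1 : ℕ) : ℝ) : ℂ) ^ β‖ ≤
      2 * ‖β‖ * Real.log m + Real.log m / Real.log P := by
  have hP0 : 0 < P := by linarith
  have hm0 : (0 : ℝ) < m := by exact_mod_cast Nat.pos_of_ne_zero hm
  have hlogP : 0 < Real.log P := Real.log_pos hP
  have hlogm : 0 ≤ Real.log m := Real.log_natCast_nonneg m
  have hPm : (0 : ℝ) < P / m := div_pos hP0 hm0
  -- the powers as exponentials
  have hne1 : ((P / m : ℝ) : ℂ) ≠ 0 := Complex.ofReal_ne_zero.mpr hPm.ne'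
  have hne2 : ((P / (1 : ℕ) : ℝ) : ℂ) ≠ 0 := by
    rw [Nat.cast_one, div_one]; exact Complex.ofReal_ne_zero.mpr hP0.ne'
  have e1 : ((P / m : ℝ) : ℂ) ^ β = Complex.exp ((Real.log P : ℂ) * β) * Complex.exp (-((Real.log m : ℂ) * β)) := by
    rw [Complex.cpow_def_of_ne_zero hne1, ← Complex.ofReal_log hPm.le, Real.log_div hP0.ne' hm0.ne',
      ← Complex.exp_add]
    push_cast; ring_nf
  have e2 : ((P / (1 : ℕ) : ℝ) : ℂ) ^ β = Complex.exp ((Real.log P : ℂ) * β) := by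
    rw [Complex.cpow_def_of_ne_zero hne2, Nat.cast_one, div_one, ← Complex.ofReal_log hP0.le]
  have hw1 : ‖Complex.exp ((Real.log P : ℂ) * β)‖ = 1 := by
    rw [Complex.norm_exp, Complex.re_ofReal_mul, hβ, mul_zero, Real.exp_zero]
  set u : ℂ := Complex.exp (-((Real.log m : ℂ) * β)) with hu
  have hu1 : ‖u - 1‖ ≤ 2 * ‖β‖ * Real.log m := by
    have hn : ‖-((Real.log m : ℂ) * β)‖ = ‖β‖ * Real.log m := by
      rw [norm_neg, norm_mul, Complex.norm_real, Real.norm_of_nonneg hlogm, mul_comm]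
    have := Complex.norm_exp_sub_one_le (x := -((Real.log m : ℂ) * β)) (by rw [hn]; exact hsmall)
    rw [hn] at this; linarith
  have hun : ‖u‖ = 1 := by
    rw [hu, Complex.norm_exp, Complex.neg_re, Complex.re_ofReal_mul, hβ, mul_zero, neg_zero, Real.exp_zero]
  rw [e1, e2, Nat.cast_one, Real.log_one, zero_div, sub_zero]
  set r : ℝ := Real.log m / Real.log P with hr
  have hr0 : 0 ≤ r := div_nonneg hlogm hlogP.le
  have hfac : ((1 - r : ℝ) : ℂ) * (Complex.exp ((Real.log P : ℂ) * β) * u) -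
      ((1 : ℝ) : ℂ) * Complex.exp ((Real.log P : ℂ) * β) =
      Complex.exp ((Real.log P : ℂ) * β) * ((u - 1) - (r : ℂ) * u) := by
    push_cast; ring
  rw [hfac, norm_mul, hw1, one_mul]
  calc ‖(u - 1) - (r : ℂ) * u‖ ≤ ‖u - 1‖ + ‖(r : ℂ) * u‖ := norm_sub_le _ _
    _ = ‖u - 1‖ + r := by rw [norm_mul, hun, mul_one, Complex.norm_real, Real.norm_of_nonneg hr0]
    _ ≤ 2 * ‖β‖ * Real.log m + r := by linarith

omit χ in
/-- `log P₁ = 0.504𝓛⁹`, `log P₂ = 0.5𝓛⁹ − 10𝓛^{1.1}`, `log P₃ = 0.498𝓛⁹`. [cite: Zhang2022LandauSiegel, §2 (2.21)] -/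
theorem log_P123 (D : ℕ) : Real.log (Skeleton.P1 D) = 0.504 * ell D ^ 9 ∧
    Real.log (Skeleton.P2 D) = 0.5 * ell D ^ 9 - 10 * ell D ^ (1.1 : ℝ) ∧ Real.log (Skeleton.P3 D) = 0.498 * ell D ^ 9 := by
  have hP := bigP_pos D
  refine ⟨?_, ?_, ?_⟩
  · rw [Skeleton.P1, Real.log_rpow hP, log_bigP]
  · rw [Skeleton.P2, Real.log_div (Real.rpow_pos_of_pos hP _).ne' (pow_pos (by rw [bigT]; exact Real.exp_pos _ : 0 < bigT D) _).ne',
      Real.log_rpow hP, log_bigP, Real.log_pow, bigT, Real.log_exp]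
    norm_num
  · rw [Skeleton.P3, Real.log_rpow hP, log_bigP]

omit χ in
/-- For `𝓛 ≥ 3`: `log P_j ≥ 0.4𝓛⁹` (`j = 1, 2, 3`; `𝓛^{1.1} ≤ 𝓛² ≤ 0.01𝓛⁹`) and `1 < P_j`.
[cite: Zhang2022LandauSiegel, §2 (2.21)] -/
theorem log_P123_ge (hℓ : 3 ≤ ell D) :
    0.4 * ell D ^ 9 ≤ Real.log (Skeleton.P1 D) ∧ 0.4 * ell D ^ 9 ≤ Real.log (Skeleton.P2 D) ∧ 0.4 * ell D ^ 9 ≤ Real.log (Skeleton.P3 D) ∧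
      1 < Skeleton.P1 D ∧ 1 < Skeleton.P2 D ∧ 1 < Skeleton.P3 D := by
  obtain ⟨h1, h2, h3⟩ := log_P123 D
  have hℓ1 : 1 ≤ ell D := by linarith
  have h9 : 0 < ell D ^ 9 := by positivity
  have hr : ell D ^ (1.1 : ℝ) ≤ ell D ^ 2 := by
    calc ell D ^ (1.1 : ℝ) ≤ ell D ^ (2 : ℝ) := Real.rpow_le_rpow_of_exponent_le hℓ1 (by norm_num)
      _ = ell D ^ 2 := by norm_cast
  have h7 : 2187 ≤ ell D ^ 7 := le_trans (by norm_num) (pow_le_pow_left₀ (by norm_num) hℓ 7)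
  have hsq : ell D ^ 2 ≤ 0.01 * ell D ^ 9 := by nlinarith [sq_nonneg (ell D)]
  have hl1 : 0.4 * ell D ^ 9 ≤ Real.log (Skeleton.P1 D) := by rw [h1]; nlinarith
  have hl2 : 0.4 * ell D ^ 9 ≤ Real.log (Skeleton.P2 D) := by rw [h2]; nlinarith
  have hl3 : 0.4 * ell D ^ 9 ≤ Real.log (Skeleton.P3 D) := by rw [h3]; nlinarith
  have pos : ∀ {P : ℝ}, 0 < P → 0.4 * ell D ^ 9 ≤ Real.log P → 1 < P := fun hP h =>
    (Real.log_pos_iff hP.le).mp (by nlinarith)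
  exact ⟨hl1, hl2, hl3, pos (Real.rpow_pos_of_pos (bigP_pos D) _) hl1,
    pos (div_pos (Real.rpow_pos_of_pos (bigP_pos D) _) (pow_pos (Real.exp_pos _) _)) hl2,
    pos (Real.rpow_pos_of_pos (bigP_pos D) _) hl3⟩

omit χ in
/-- **`|ϰ_j(m) − ϰ_j(1)| ≤ (20π + 10)𝓛⁻⁸`** for `1 ≤ m < D⁴ ≤ P_j` (`𝓛 ≥ 3`; `j = 1, 2, 3`; `ϰ₄ = ϰ₂`).
[cite: Zhang2022LandauSiegel, §8 (8.6); §17 (17.4)] -/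
theorem norm_vk_sub_vk_one_le (hℓ : 3 ≤ ell D) (hD4 : ((D ^ 4 : ℕ) : ℝ) ≤ Skeleton.P2 D) (hD4' : ((D ^ 4 : ℕ) : ℝ) ≤ Skeleton.P3 D)
    {m : ℕ} (hm : m ≠ 0) (hm4 : m < D ^ 4) :
    ‖vk1 D m - vk1 D 1‖ ≤ (20 * π + 10) * (ell D ^ 8)⁻¹ ∧ ‖vk2 D m - vk2 D 1‖ ≤ (20 * π + 10) * (ell D ^ 8)⁻¹ ∧
      ‖vk3 D m - vk3 D 1‖ ≤ (20 * π + 10) * (ell D ^ 8)⁻¹ := by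
  have hD : 1 ≤ Real.log D := by rw [← ell]; linarith
  obtain ⟨hl1, hl2, hl3, hP1, hP2, hP3⟩ := log_P123_ge (D := D) hℓ
  obtain ⟨h6, h7⟩ := Sec12D.norm_beta67 (D := D) hD
  have hαℓ := Sec12D.alpha_mul_ell_eq (D := D) hD
  have hα := Sec12D.alpha_pos_of_log (D := D) hD
  have hℓ0 : 0 < ell D := by linarith
  have h8 : 0 < ell D ^ 8 := by positivity
  have hlog := log_le_four_ell (D := D) hm4
  have hlog0 : 0 ≤ Real.log m := Real.log_natCast_nonneg m
  have hre6 : (beta6 D).re = 0 := by simp [beta6]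
  have hre7 : (beta7 D).re = 0 := by simp [beta7]
  -- `P₂ ≤ P₁`, so `m < D⁴ ≤ P₂ ≤ P₁`
  have hmD : (m : ℝ) < ((D ^ 4 : ℕ) : ℝ) := by exact_mod_cast hm4
  have hP21 : Skeleton.P2 D ≤ Skeleton.P1 D := by
    have hP := bigP_pos D
    have hT1 : 1 ≤ bigT D ^ 10 := one_le_pow₀ (by rw [bigT]; exact Real.one_le_exp (by positivity))
    calc Skeleton.P2 D ≤ bigP D ^ (0.5 : ℝ) := div_le_self (Real.rpow_nonneg hP.le _) hT1
      _ ≤ bigP D ^ (0.504 : ℝ) := Real.rpow_le_rpow_of_exponent_le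
          (by rw [bigP]; exact Real.one_le_exp (by positivity)) (by norm_num)
  have hm1 : (m : ℝ) < Skeleton.P1 D := by linarith
  have hm2 : (m : ℝ) < Skeleton.P2 D := by linarith
  have hm3 : (m : ℝ) < Skeleton.P3 D := by linarith
  -- the smallness `|β| log m ≤ 1`: `(5α/2)(4𝓛) = 10π𝓛⁻⁸ ≤ 1`
  have hten : 10 * (alpha D * ell D) ≤ 1 := by
    rw [hαℓ]
    have : 6561 ≤ ell D ^ 8 := le_trans (by norm_num) (pow_le_pow_left₀ (by norm_num) hℓ 8)
    rw [show 10 * (π * (ell D ^ 8)⁻¹) = 10 * π / ell D ^ 8 by ring, div_le_one h8]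
    nlinarith [Real.pi_lt_four]
  have hs6 : ‖beta6 D‖ * Real.log m ≤ 1 := by
    rw [h6]; calc 3 * alpha D / 2 * Real.log m ≤ 3 * alpha D / 2 * (4 * ell D) := by gcongr
      _ = 6 * (alpha D * ell D) := by ring
      _ ≤ 1 := by linarith
  have hs7 : ‖beta7 D‖ * Real.log m ≤ 1 := by
    rw [h7]; calc 5 * alpha D / 2 * Real.log m ≤ 5 * alpha D / 2 * (4 * ell D) := by gcongr
      _ = 10 * (alpha D * ell D) := by ring
      _ ≤ 1 := hten
  -- the generic bound and its evaluation
  have fin : ∀ {β : ℂ} {P : ℝ}, ‖β‖ ≤ 5 * alpha D / 2 → 0.4 * ell D ^ 9 ≤ Real.log P →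
      2 * ‖β‖ * Real.log m + Real.log m / Real.log P ≤ (20 * π + 10) * (ell D ^ 8)⁻¹ := by
    intro β P hβ hP
    have hlP : 0 < Real.log P := lt_of_lt_of_le (by positivity) hP
    have t1 : 2 * ‖β‖ * Real.log m ≤ 20 * (alpha D * ell D) := by
      calc 2 * ‖β‖ * Real.log m ≤ 2 * (5 * alpha D / 2) * (4 * ell D) :=
            mul_le_mul (by linarith) hlog hlog0 (by positivity)
        _ = 20 * (alpha D * ell D) := by ring
    have t2 : Real.log m / Real.log P ≤ 10 * (ell D ^ 8)⁻¹ := by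
      rw [div_le_iff₀ hlP]
      calc Real.log m ≤ 4 * ell D := hlog
        _ = 10 * (ell D ^ 8)⁻¹ * (0.4 * ell D ^ 9) := by field_simp; ring
        _ ≤ 10 * (ell D ^ 8)⁻¹ * Real.log P := by gcongr
    rw [hαℓ] at t1
    nlinarith
  refine ⟨?_, ?_, ?_⟩
  · rw [vk1, vk1, if_pos hm1, if_pos (by exact_mod_cast hP1 : ((1 : ℕ) : ℝ) < Skeleton.P1 D)]
    exact (norm_vkFactor_sub_le hP1 hre6 hm hs6).trans (fin (by rw [h6]; linarith) hl1)
  · rw [vk2, vk2, if_pos hm2, if_pos (by exact_mod_cast hP2 : ((1 : ℕ) : ℝ) < Skeleton.P2 D)]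
    exact (norm_vkFactor_sub_le hP2 hre7 hm hs7).trans (fin (by rw [h7]) hl2)
  · rw [vk3, vk3, if_pos hm3, if_pos (by exact_mod_cast hP3 : ((1 : ℕ) : ℝ) < Skeleton.P3 D)]
    exact (norm_vkFactor_sub_le hP3 hre6 hm hs6).trans (fin (by rw [h6]; linarith) hl3)

/-- **`|χ(m)(ϰ₁(m)+ι₂ϰ₂(m)) − (ϰ₁(1)+ι₂ϰ₂(1))χ(m)| ≤ (1+|ι₂|)(20π+10)𝓛⁻⁸`** and the `ῑ₃ϰ₃+ῑ₄ϰ₄` analogue,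
for `1 ≤ m < D⁴` (`𝓛 ≥ 3`, `D⁴ ≤ P₂, P₃`). [cite: Zhang2022LandauSiegel, §17 u007 p.96, (17.4)] -/
theorem norm_A12_sub_le (hℓ : 3 ≤ ell D) (hD4 : ((D ^ 4 : ℕ) : ℝ) ≤ Skeleton.P2 D) (hD4' : ((D ^ 4 : ℕ) : ℝ) ≤ Skeleton.P3 D)
    {m : ℕ} (hm : m ≠ 0) (hm4 : m < D ^ 4) :
    ‖χ (m : ZMod D) * (vk1 D m + iota2 * vk2 D m) - (vk1 D 1 + iota2 * vk2 D 1) * χ (m : ZMod D)‖ ≤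
        (1 + ‖iota2‖) * ((20 * π + 10) * (ell D ^ 8)⁻¹) ∧
      ‖χ (m : ZMod D) * (conj iota3 * vk3 D m + conj iota4 * vk4 D m) -
          (conj iota3 * vk3 D 1 + conj iota4 * vk4 D 1) * χ (m : ZMod D)‖ ≤
        (‖iota3‖ + ‖iota4‖) * ((20 * π + 10) * (ell D ^ 8)⁻¹) := by
  obtain ⟨h1, h2, h3⟩ := norm_vk_sub_vk_one_le (D := D) hℓ hD4 hD4' hm hm4
  have hχ : ‖χ (m : ZMod D)‖ ≤ 1 := DirichletCharacter.norm_le_one χ _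
  set e : ℝ := (20 * π + 10) * (ell D ^ 8)⁻¹ with he
  have he0 : 0 ≤ e := le_trans (norm_nonneg _) h1
  constructor
  · have hf : χ (m : ZMod D) * (vk1 D m + iota2 * vk2 D m) - (vk1 D 1 + iota2 * vk2 D 1) * χ (m : ZMod D) =
        χ (m : ZMod D) * ((vk1 D m - vk1 D 1) + iota2 * (vk2 D m - vk2 D 1)) := by ring
    rw [hf, norm_mul]
    calc ‖χ (m : ZMod D)‖ * ‖(vk1 D m - vk1 D 1) + iota2 * (vk2 D m - vk2 D 1)‖
        ≤ 1 * (‖vk1 D m - vk1 D 1‖ + ‖iota2‖ * ‖vk2 D m - vk2 D 1‖) := by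
          refine mul_le_mul hχ ((norm_add_le _ _).trans ?_) (norm_nonneg _) zero_le_one
          rw [norm_mul]
      _ ≤ 1 * (e + ‖iota2‖ * e) := by gcongr
      _ = (1 + ‖iota2‖) * e := by ring
  · have hf : χ (m : ZMod D) * (conj iota3 * vk3 D m + conj iota4 * vk4 D m) -
        (conj iota3 * vk3 D 1 + conj iota4 * vk4 D 1) * χ (m : ZMod D) =
        χ (m : ZMod D) * (conj iota3 * (vk3 D m - vk3 D 1) + conj iota4 * (vk2 D m - vk2 D 1)) := by
      simp only [vk4]; ring
    rw [hf, norm_mul]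
    calc ‖χ (m : ZMod D)‖ * ‖conj iota3 * (vk3 D m - vk3 D 1) + conj iota4 * (vk2 D m - vk2 D 1)‖
        ≤ 1 * (‖iota3‖ * ‖vk3 D m - vk3 D 1‖ + ‖iota4‖ * ‖vk2 D m - vk2 D 1‖) := by
          refine mul_le_mul hχ ((norm_add_le _ _).trans ?_) (norm_nonneg _) zero_le_one
          rw [norm_mul, norm_mul, Complex.norm_conj, Complex.norm_conj]
      _ ≤ 1 * (‖iota3‖ * e + ‖iota4‖ * e) := by gcongr
      _ = (‖iota3‖ + ‖iota4‖) * e := by ring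

/-! ## (17.4): `𝔢₀ᴰ` versus `𝔢₀` -/

omit χ in
/-- **`ϰ₁(1) = e^{0.756πi}`, `ϰ₃(1) = e^{0.747πi}` exactly, and `|ϰ₂(1) − e^{1.25πi}| ≤ 50α𝓛²`** (`𝓛 ≥ 3`):
`ϰ_j(1) = P_j^{β}`, `log P₁·β₆ = 0.504·(3/2)·α𝓛⁹·i = 0.756πi` (`α𝓛⁹ = π`), `log P₂·β₇ = 1.25πi − 25iα𝓛^{1.1}`
("`T^{−10β₇} = 1 + O(𝓛^{−7.9})`"). [cite: Zhang2022LandauSiegel, §17 (17.4); §8 (8.6); §2 (2.21)–(2.22)] -/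
theorem vk_one (hℓ : 3 ≤ ell D) :
    vk1 D 1 = vk1one ∧ vk3 D 1 = vk3one ∧ ‖vk2 D 1 - vk2one‖ ≤ 50 * (alpha D * ell D ^ 2) := by
  obtain ⟨hl1, hl2, hl3⟩ := log_P123 D
  obtain ⟨-, -, -, hP1, hP2, hP3⟩ := log_P123_ge (D := D) hℓ
  have hℓ1 : 1 ≤ ell D := by linarith
  have hD : 1 ≤ Real.log D := by rw [← ell]; linarith
  have hα9 : alpha D * ell D ^ 9 = π := by
    rw [Section2.alpha_eq_pi_div_ell9]; field_simp
  have hα := Sec12D.alpha_pos_of_log (D := D) hD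
  have cpow1 : ∀ {P : ℝ}, 1 < P → ∀ β : ℂ,
      ((1 - Real.log (1 : ℕ) / Real.log P : ℝ) : ℂ) * ((P / (1 : ℕ) : ℝ) : ℂ) ^ β =
        Complex.exp ((Real.log P : ℂ) * β) := by
    intro P hP β
    have hP0 : 0 < P := by linarith
    rw [Nat.cast_one, Real.log_one, zero_div, sub_zero, div_one, Complex.ofReal_one, one_mul,
      Complex.cpow_def_of_ne_zero (Complex.ofReal_ne_zero.mpr hP0.ne'), ← Complex.ofReal_log hP0.le]
  refine ⟨?_, ?_, ?_⟩
  · rw [vk1, if_pos (by exact_mod_cast hP1 : ((1 : ℕ) : ℝ) < Skeleton.P1 D), cpow1 hP1, hl1, vk1one, beta6]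
    congr 1
    rw [show (0.756 : ℂ) * π = ((0.756 * π : ℝ) : ℂ) by push_cast; ring, ← hα9]
    push_cast; ring
  · rw [vk3, if_pos (by exact_mod_cast hP3 : ((1 : ℕ) : ℝ) < Skeleton.P3 D), cpow1 hP3, hl3, vk3one, beta6]
    congr 1
    rw [show (0.747 : ℂ) * π = ((0.747 * π : ℝ) : ℂ) by push_cast; ring, ← hα9]
    push_cast; ring
  · rw [vk2, if_pos (by exact_mod_cast hP2 : ((1 : ℕ) : ℝ) < Skeleton.P2 D), cpow1 hP2, hl2, vk2one, beta7]
    -- `exp(log P₂ β₇) = exp(1.25πi) · exp(−25 i α 𝓛^{1.1})`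
    set z : ℂ := -(((25 * alpha D * ell D ^ (1.1 : ℝ) : ℝ) : ℂ) * I) with hz
    have hsplit : (((0.5 * ell D ^ 9 - 10 * ell D ^ (1.1 : ℝ) : ℝ) : ℂ)) * (5 * I * (alpha D : ℂ) / 2) =
        1.25 * π * I + z := by
      rw [hz, show (1.25 : ℂ) * π = ((1.25 * π : ℝ) : ℂ) by push_cast; ring, ← hα9]
      push_cast; ring
    rw [hsplit, Complex.exp_add]
    have hn1 : ‖Complex.exp (1.25 * π * I)‖ = 1 := by
      rw [show (1.25 : ℂ) * π * I = ((1.25 * π : ℝ) : ℂ) * I by push_cast; ring, Complex.norm_exp_ofReal_mul_I]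
    have hr : ell D ^ (1.1 : ℝ) ≤ ell D ^ 2 := by
      calc ell D ^ (1.1 : ℝ) ≤ ell D ^ (2 : ℝ) := Real.rpow_le_rpow_of_exponent_le hℓ1 (by norm_num)
        _ = ell D ^ 2 := by norm_cast
    have hr0 : 0 ≤ ell D ^ (1.1 : ℝ) := Real.rpow_nonneg (by linarith) _
    have hzn : ‖z‖ = 25 * alpha D * ell D ^ (1.1 : ℝ) := by
      rw [hz, norm_neg, norm_mul, Complex.norm_I, mul_one, Complex.norm_real,
        Real.norm_of_nonneg (by positivity)]
    have hz1 : ‖z‖ ≤ 1 := by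
      rw [hzn]
      have hαℓ := Sec12D.alpha_mul_ell_eq (D := D) hD
      have h7 : 2187 ≤ ell D ^ 7 := le_trans (by norm_num) (pow_le_pow_left₀ (by norm_num) hℓ 7)
      calc 25 * alpha D * ell D ^ (1.1 : ℝ) ≤ 25 * alpha D * ell D ^ 2 := by gcongr
        _ = 25 * π * (ell D ^ 8)⁻¹ * ell D := by
            rw [show 25 * alpha D * ell D ^ 2 = 25 * (alpha D * ell D) * ell D by ring, hαℓ]; ring
        _ = 25 * π / ell D ^ 7 := by field_simp
        _ ≤ 1 := by rw [div_le_one (by positivity)]; nlinarith [Real.pi_lt_four]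
    have key := Complex.norm_exp_sub_one_le hz1
    calc ‖Complex.exp (1.25 * π * I) * Complex.exp z - Complex.exp (1.25 * π * I)‖
        = ‖Complex.exp (1.25 * π * I)‖ * ‖Complex.exp z - 1‖ := by rw [← norm_mul]; ring_nf
      _ ≤ 1 * (2 * ‖z‖) := by rw [hn1]; exact mul_le_mul_of_nonneg_left key zero_le_one
      _ = 50 * alpha D * ell D ^ (1.1 : ℝ) := by rw [hzn]; ring
      _ ≤ 50 * alpha D * ell D ^ 2 := by gcongr
      _ = 50 * (alpha D * ell D ^ 2) := by ring

omit χ in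
/-- **`|𝔢₀ᴰ − 𝔢₀| ≤ 100(1+|ι₂|)(|ι₃|+|ι₄|)·α𝓛²`** (`𝓛 ≥ 3`): only `ϰ₂(1) = ϰ₄(1)` differs from its
main-term value. [cite: Zhang2022LandauSiegel, §17 (17.4)] -/
theorem norm_frake0D_sub_frake0_le (hℓ : 3 ≤ ell D) :
    ‖frake0D D - frake0‖ ≤ 100 * (1 + ‖iota2‖) * (‖iota3‖ + ‖iota4‖) * (alpha D * ell D ^ 2) := by
  obtain ⟨h1, h3, h2⟩ := vk_one (D := D) hℓ
  have hD : 2 ≤ Real.log D := by rw [← ell]; linarith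
  set d : ℂ := vk2 D 1 - vk2one with hd
  have hv2 : ‖vk2 D 1‖ ≤ 1 := norm_vk2_le hD 1
  have hv20 : ‖vk2one‖ = 1 := by
    rw [vk2one, show (1.25 : ℂ) * π * I = ((1.25 * π : ℝ) : ℂ) * I by push_cast; ring,
      Complex.norm_exp_ofReal_mul_I]
  have hv1 : ‖vk1one‖ = 1 := by
    rw [vk1one, show (0.756 : ℂ) * π * I = ((0.756 * π : ℝ) : ℂ) * I by push_cast; ring,
      Complex.norm_exp_ofReal_mul_I]
  have hv3 : ‖vk3one‖ = 1 := by
    rw [vk3one, show (0.747 : ℂ) * π * I = ((0.747 * π : ℝ) : ℂ) * I by push_cast; ring,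
      Complex.norm_exp_ofReal_mul_I]
  have hexp : frake0D D - frake0 =
      iota2 * d * (conj iota3 * vk3one + conj iota4 * vk2 D 1) + (vk1one + iota2 * vk2one) * (conj iota4 * d) := by
    rw [frake0D, frake0, h1, h3, vk4, vk4one, hd]; ring
  rw [hexp]
  have hA : ‖conj iota3 * vk3one + conj iota4 * vk2 D 1‖ ≤ ‖iota3‖ + ‖iota4‖ := by
    calc ‖conj iota3 * vk3one + conj iota4 * vk2 D 1‖ ≤ ‖conj iota3 * vk3one‖ + ‖conj iota4 * vk2 D 1‖ :=
          norm_add_le _ _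
      _ ≤ ‖iota3‖ * 1 + ‖iota4‖ * 1 := by
          rw [norm_mul, norm_mul, Complex.norm_conj, Complex.norm_conj, hv3]
          gcongr
      _ = ‖iota3‖ + ‖iota4‖ := by ring
  have hB : ‖vk1one + iota2 * vk2one‖ ≤ 1 + ‖iota2‖ := by
    calc ‖vk1one + iota2 * vk2one‖ ≤ ‖vk1one‖ + ‖iota2 * vk2one‖ := norm_add_le _ _
      _ = 1 + ‖iota2‖ := by rw [norm_mul, hv1, hv20, mul_one]
  have hι2 : 0 ≤ ‖iota2‖ := norm_nonneg _
  have hι3 : 0 ≤ ‖iota3‖ := norm_nonneg _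
  have hι4 : 0 ≤ ‖iota4‖ := norm_nonneg _
  have hd0 : 0 ≤ ‖d‖ := norm_nonneg _
  calc ‖iota2 * d * (conj iota3 * vk3one + conj iota4 * vk2 D 1) + (vk1one + iota2 * vk2one) * (conj iota4 * d)‖
      ≤ ‖iota2‖ * ‖d‖ * (‖iota3‖ + ‖iota4‖) + (1 + ‖iota2‖) * (‖iota4‖ * ‖d‖) := by
        refine (norm_add_le _ _).trans (add_le_add ?_ ?_)
        · rw [norm_mul, norm_mul]; gcongr
        · rw [norm_mul, norm_mul, Complex.norm_conj]
          exact mul_le_mul_of_nonneg_right hB (by positivity)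
    _ ≤ 2 * (1 + ‖iota2‖) * (‖iota3‖ + ‖iota4‖) * ‖d‖ := by nlinarith [mul_nonneg hι2 hd0, mul_nonneg hι3 hd0, mul_nonneg hι4 hd0]
    _ ≤ 2 * (1 + ‖iota2‖) * (‖iota3‖ + ‖iota4‖) * (50 * (alpha D * ell D ^ 2)) := by gcongr
    _ = 100 * (1 + ‖iota2‖) * (‖iota3‖ + ‖iota4‖) * (alpha D * ell D ^ 2) := by ring

end Literature.NumberTheory.LFunctions.Zhang2022.U007

end
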